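import Summits.AnomalousDissipation.AnomalousDissipation.Theorems.WazewskiBlockUniformGalerkinTrapSteadyFixedPoint

/-!
# Equilibria of `Torus.galerkinFlow` ARE the steady Galerkin states (converse of `stub_steadyFixedPoint`)
# — dictionary for the line `SketchIdeator1` of the crux stmt-AnomalousDissipation-10352 (`WazewskiBlock.UniformGalerkinTrap`)

`Theorems/WazewskiBlockUniformGalerkinTrapSteadyFixedPoint.lean` (p102267) proves: tested steady Galerkin equations ⇒
equilibrium of the Galerkin semiflow.  This definition-free support file proves the converse, so that the two
formulations of the line's frozen arm (`FrozenLoudAllLevels`: fixed points of `Torus.galerkinFlow ν f N`;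
`SteadyLoudAllLevels`: steady Galerkin states) are interchangeable:

* `galerkinRHS_eq_zero_of_galerkinFlow_eq_self` — on an equilibrium the Galerkin vector field vanishes (the coefficient
  orbit is constant on `[0,1]`, its right derivative at `0` is both `galerkinRHS` and `0`; uniqueness of one-sided
  derivatives on `[0,1]`);
* `steady_of_galerkinRHS_eq_zero` — a zero of `galerkinRHS` solves the tested steady Galerkin equations against every
  Galerkin mode (master identity `Torus.sum_re_inner_galerkinField_test`, force `P_N f ↦ f` against band-limited tests);
* `galerkinFlow_eq_self_iff_steady` — equilibrium ⇔ steady state, for a Galerkin mode `U` of order `N`, `ν ≥ 0`, `f ∈ L²`.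

References: Robinson–Rodrigo–Sadowski 2016 §4.1, Thm 4.4 Step 1 (4.5); Temam 1979 Ch. II §1 (1.25); Constantin–Foias 1988 Ch. 8.
-/

noncomputable section

-- `Summit.<Summit>.<Problem>` is the tree's mandated summit-side namespace (CONVENTIONS §2); deliberate duplicate.
set_option linter.dupNamespace false

open MeasureTheory Set UnitAddTorus
open scoped InnerProductSpace

namespace Summit.AnomalousDissipation.AnomalousDissipation.Theorems.UniformGalerkinTrap

open Literature.Analysis.FunctionSpaces Literature.Analysis.FunctionSpaces.Torus
open Literature.Analysis.FluidPDE Literature.Analysis.FluidPDE.Torus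

variable {d : Type*} [Fintype d] [DecidableEq d]

/-- **On an equilibrium of the Galerkin semiflow the Galerkin vector field vanishes.** If `U` is a Galerkin mode of
order `N` with `Torus.galerkinFlow ν f N t U = U` for all `t ≥ 0` (`ν ≥ 0`, `f` integrable), then
`galerkinRHS (freqBall N) ν f̂|_{≤N} Û|_{≤N} = 0`: the coefficient orbit `t ↦ φ_t Û` is constant on `[0,1]`
(conjugacy `IsGalerkinMode.fourierRestrict_galerkinFlow`), and its right derivative at `0` is `galerkinRHS … Û`
(`isGalerkinODESolution_galerkinCoeffFlow`) as well as `0`. [folklore] -/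
theorem galerkinRHS_eq_zero_of_galerkinFlow_eq_self {ν : ℝ} (hν : 0 ≤ ν) {N : ℕ}
    {f U : UnitAddTorus d → EuclideanSpace ℝ d} (hf : Integrable f volume) (hU : IsGalerkinMode N U)
    (hfix : ∀ t : ℝ, 0 ≤ t → Torus.galerkinFlow ν f N t U = U) :
    galerkinRHS (freqBall N) ν (fourierRestrict (freqBall N) f) (fourierRestrict (freqBall N) U) = 0 := by
  have hS : ∀ k ∈ freqBall (d := d) N, -k ∈ freqBall (d := d) N := neg_mem_freqBall_of_mem
  have hg : IsRealCoeff (fourierRestrict (freqBall N) f) := isRealCoeff_mFourierCoeff hf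
  have hsol := isGalerkinODESolution_galerkinCoeffFlow hν hS hg hU.fourierRestrict_mem (ν := ν)
  -- the orbit is constant on `[0, ∞)`
  have hconst : ∀ t : ℝ, 0 ≤ t → galerkinCoeffFlow ν (fourierRestrict (freqBall N) f) t
      (fourierRestrict (freqBall N) U) = fourierRestrict (freqBall N) U := by
    intro t ht
    rw [← hU.fourierRestrict_galerkinFlow t, hfix t ht]
  -- right derivative at `0` within `[0,1]`: `galerkinRHS` (ODE) and `0` (constant)
  have h1 : HasDerivWithinAt (fun t => galerkinCoeffFlow ν (fourierRestrict (freqBall N) f) t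
      (fourierRestrict (freqBall N) U))
      (galerkinRHS (freqBall N) ν (fourierRestrict (freqBall N) f) (fourierRestrict (freqBall N) U)) (Icc 0 1) 0 := by
    have h := hsol.hasDerivWithinAt 1 0 ⟨le_rfl, zero_le_one⟩
    rwa [galerkinCoeffFlow_zero] at h
  have h2 : HasDerivWithinAt (fun t => galerkinCoeffFlow ν (fourierRestrict (freqBall N) f) t
      (fourierRestrict (freqBall N) U)) 0 (Icc 0 1) 0 :=
    (hasDerivWithinAt_const (0 : ℝ) (Icc (0 : ℝ) 1) (fourierRestrict (freqBall N) U)).congr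
      (fun t ht => hconst t ht.1) (hconst 0 le_rfl)
  have huniq : UniqueDiffWithinAt ℝ (Icc (0 : ℝ) 1) 0 := uniqueDiffOn_Icc zero_lt_one 0 ⟨le_rfl, zero_le_one⟩
  exact huniq.eq_deriv _ h1 h2

/-- **A zero of the Galerkin vector field is a steady Galerkin state**: if `U` is a Galerkin mode of order `N` with
`galerkinRHS (freqBall N) ν f̂|_{≤N} Û|_{≤N} = 0` (`f ∈ L²`), then `∫ ⟪U,(U·∇)a⟫ + ν⟪U,Δa⟫ + ⟪f,a⟫ = 0` for every
Galerkin mode `a` of order `N` (master identity with the left-hand side `∑ Re⟪0, â k⟫ = 0`, and `P_N f ↦ f` against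
the band-limited `a`). [folklore] -/
theorem steady_of_galerkinRHS_eq_zero {ν : ℝ} {N : ℕ} {f U : UnitAddTorus d → EuclideanSpace ℝ d}
    (hf : MemLp f 2 volume) (hU : IsGalerkinMode N U)
    (h0 : galerkinRHS (freqBall N) ν (fourierRestrict (freqBall N) f) (fourierRestrict (freqBall N) U) = 0)
    {a : UnitAddTorus d → EuclideanSpace ℝ d} (ha : IsGalerkinMode N a) :
    ∫ x, (⟪U x, convect U a x⟫_ℝ + ν * ⟪U x, laplacian a x⟫_ℝ + ⟪f x, a x⟫_ℝ) = 0 := by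
  have hS : ∀ k ∈ freqBall (d := d) N, -k ∈ freqBall (d := d) N := neg_mem_freqBall_of_mem
  have hg : IsRealCoeff (fourierRestrict (freqBall N) f) := isRealCoeff_mFourierCoeff (hf.integrable one_le_two)
  have hc : fourierRestrict (freqBall N) U ∈ galerkinSubspace (freqBall N) := hU.fourierRestrict_mem
  have hband : ∀ k ∉ freqBall N, mFourierCoeff (EuclideanSpace.complexify ∘ a) k = 0 :=
    fun k hk => ha.mFourierCoeff_eq_zero (not_mem_freqBall.1 hk)
  have hid := sum_re_inner_galerkinField_test ν hS (hg.isConjSymm_coeffExt hS)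
    (hc.1.isConjSymm_coeffExt hS) hc.2.isTransversal_coeffExt ha.isSmooth ha.isDivFree hband
  rw [hU.realTrigPoly_fourierRestrict, realTrigPoly_coeffExt_fourierRestrict] at hid
  -- the left-hand side vanishes
  have hzero : ∑ k ∈ freqBall N, (inner ℂ (galerkinField ν (freqBall N) (coeffExt (freqBall N) (fourierRestrict (freqBall N) f))
      (coeffExt (freqBall N) (fourierRestrict (freqBall N) U)) k) (mFourierCoeff (EuclideanSpace.complexify ∘ a) k)).re = 0 := by
    refine Finset.sum_eq_zero fun k hk => ?_
    have hk0 : galerkinField ν (freqBall N) (coeffExt (freqBall N) (fourierRestrict (freqBall N) f))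
        (coeffExt (freqBall N) (fourierRestrict (freqBall N) U)) k = 0 := by
      rw [← galerkinRHS_apply ν _ _ ⟨k, hk⟩, h0]
      rfl
    rw [hk0, inner_zero_left, Complex.zero_re]
  rw [hzero] at hid
  -- replace `P_N f` by `f`
  have hforce : ∫ x, ⟪fourierTruncate N f x, a x⟫_ℝ = ∫ x, ⟪f x, a x⟫_ℝ :=
    integral_inner_fourierTruncate_eq hf (ha.isSmooth.memLp 2) hband
  have hUs : IsSmooth U := hU.isSmooth
  have iAB : Integrable (fun x => ⟪U x, convect U a x⟫_ℝ + ν * ⟪U x, laplacian a x⟫_ℝ) volume :=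
    (hUs.inner (hUs.convect ha.isSmooth)).integrable.add
      (((hUs.inner ha.isSmooth.laplacian).integrable).const_mul ν)
  have iP : Integrable (fun x => ⟪fourierTruncate N f x, a x⟫_ℝ) volume :=
    ((isSmooth_fourierTruncate N f).inner ha.isSmooth).integrable
  have iF : Integrable (fun x => ⟪f x, a x⟫_ℝ) volume :=
    integrable_inner_of_continuous (hf.integrable one_le_two) ha.isSmooth.continuous
  rw [integral_add iAB iF, ← hforce, ← integral_add iAB iP]
  exact hid.symm

/-- **Equilibria of the Galerkin semiflow ARE the steady Galerkin states.** For a Galerkin mode `U` of order `N`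
(`ν ≥ 0`, `f ∈ L²`): `Torus.galerkinFlow ν f N t U = U` for all `t ≥ 0` iff `U` solves the tested steady Galerkin
equations against every Galerkin mode of order `N` (`stub_steadyFixedPoint`, p102267, for ⇐). [folklore] -/
theorem galerkinFlow_eq_self_iff_steady {ν : ℝ} (hν : 0 ≤ ν) {N : ℕ} {f U : UnitAddTorus d → EuclideanSpace ℝ d}
    (hf : MemLp f 2 volume) (hU : IsGalerkinMode N U) :
    (∀ t : ℝ, 0 ≤ t → Torus.galerkinFlow ν f N t U = U) ↔
      ∀ a : UnitAddTorus d → EuclideanSpace ℝ d, IsGalerkinMode N a →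
        ∫ x, (⟪U x, convect U a x⟫_ℝ + ν * ⟪U x, laplacian a x⟫_ℝ + ⟪f x, a x⟫_ℝ) = 0 :=
  ⟨fun hfix _ ha => steady_of_galerkinRHS_eq_zero hf hU
      (galerkinRHS_eq_zero_of_galerkinFlow_eq_self hν (hf.integrable one_le_two) hU hfix) ha,
    fun hsteady _ ht => galerkinFlow_eq_self_of_rhs_zero hU
      (galerkinRHS_fourierRestrict_eq_zero_of_steady hf hU hsteady) ht⟩

/-- **Registered sub-goal `equilibria_iff_steady_glue` of stmt-AnomalousDissipation-10352** (binder-free form on `T³` of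
`galerkinFlow_eq_self_iff_steady`, through which this file lands `--supports`): for `ν ≥ 0`, `f ∈ L²` and a Galerkin mode
`U` of order `N`, `U` is an equilibrium of `Torus.galerkinFlow ν f N` iff it solves the tested steady Galerkin equations. [folklore] -/
theorem equilibria_iff_steady_glue : ∀ (ν : ℝ) (N : ℕ) (f U : UnitAddTorus (Fin 3) → EuclideanSpace ℝ (Fin 3)), 0 ≤ ν → MemLp f 2 volume → IsGalerkinMode N U → ((∀ t : ℝ, 0 ≤ t → Torus.galerkinFlow ν f N t U = U) ↔ ∀ a : UnitAddTorus (Fin 3) → EuclideanSpace ℝ (Fin 3), IsGalerkinMode N a → ∫ x, (⟪U x, convect U a x⟫_ℝ + ν * ⟪U x, laplacian a x⟫_ℝ + ⟪f x, a x⟫_ℝ) = 0) :=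
  fun _ _ _ _ hν hf hU => galerkinFlow_eq_self_iff_steady hν hf hU

end Summit.AnomalousDissipation.AnomalousDissipation.Theorems.UniformGalerkinTrap

end
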